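import Summits.BirchSwinnertonDyer.BirchSwinnertonDyer.Theorems.CountingDoorF2AtThreeSchneiderOnDoorSubfamilyTransport
import Literature.NumberTheory.EllipticCurves.CanonicalPAdicHeightJunkSigmaProofs
import HarnessLib

/-!
# Route `CountingDoorF2AtThree`, crux I4loc `SchneiderOnDoorSubfamily` (stmt-BirchSwinnertonDyer-19682) —
# registered stub `stub_transport` of line `valuation-class-at-three` (skeleton v3, sha ad82ec43829a),
# UNCONDITIONALLY (part 3/3 of seat bsd-rank2-cd-transport)

Cell `bsd-rank2`, seat `bsd-rank2-cd-transport` (PART 1b ACCEL row (4); `--supports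
stmt-BirchSwinnertonDyer-19682`). THEOREMS ONLY (no definition, no named fact, no `sorry`; nothing
reads an analytic rank).

The stub, token for token as registered: for a member `a` of Bhargava–Ho's `F₂` whose discriminant
passes the square-free sieve (`ℓ² ∤ Δ(a)` at every prime), Schneider's non-degeneracy of every
CANONICAL `3`-adic height datum on the member's integral model `a.curve` (in Mordell–Weil rank `2`)
transfers to every canonical datum on every globally minimal model `C • a.curve` ordinary at `3` of
Mordell–Weil rank `2`.

Proof. `a.curve` is globally minimal (`isGloballyMinimal_curve_of_squarefree`), so `C = (±1, r, s, t)`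
with `r, s, t ∈ ℤ` (`isGloballyMinimal_unique_holds`) and `Δ(C • a.curve) = Δ(a)`; as `4 ∤ Δ(a)`,
`16 ∤ Δ(C • a.curve)` and so `(a₁', a₃') ≠ (0, 0)` on `C • a.curve`
(`a₁_ne_zero_or_a₃_ne_zero_of_not_sixteen_dvd`). A canonical datum `Dh` on `C • a.curve` (rank
`2 ≠ 0`, `p = 3` odd) therefore lives in the genuine branch: a Mazur–Tate pair EXISTS for
`(C • a.curve) ⊗ ℚ_3` (`PAdicHeightData.IsCanonical.exists_isMazurTateSigmaPair_of_mordellWeilRank_ne_zero`,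
tree file `CanonicalPAdicHeightJunkSigmaProofs`: in the junk branch `σ = t` the points `Q` and `-Q`
would have different sigma-formula heights). With that pair the transport of part 2 applies
(`schneiderConjecture_transport`: the pull-back of `Dh` along `pointEquiv a.curve C` is THE canonical
datum of `a.curve`, non-degenerate by hypothesis, and non-degeneracy passes through a Mordell–Weil
basis), `a.curve` being good ordinary at `3` because `C • a.curve` is
(`good_ordinary_three_curve_of_smul`). No existence input for the `3`-adic sigma function is used.

PARTITION: none — r_an ≥ 2, summit axis S0; TWIN (D-0056): n/a. B1 honesty: model-change
bookkeeping, no S0 motion.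

References: B. Mazur, W. Stein, J. Tate, Doc. Math. Extra Vol. (2006) Thm. 1.3, §1 [MazurSteinTate2006];
B. Mazur, J. Tate, Duke Math. J. 62 (1991) Thm. 3.1 [MazurTate1991]; J. H. Silverman, *AEC* (2009)
III.1, VII.1.3(b), VIII.8.3 [SilvermanAEC2009].
-/

noncomputable section

-- the Theorems namespace of a single-conjunct summit repeats the summit name by design (D-0017)
set_option linter.dupNamespace false

open scoped Classical
open WeierstrassCurve Literature.NumberTheory.EllipticCurves
open Literature.NumberTheory.EllipticCurves.BhargavaHo2022
open Summit.BirchSwinnertonDyer.BirchSwinnertonDyer.Theses.CountingDoorF2AtThree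

namespace Summit.BirchSwinnertonDyer.BirchSwinnertonDyer.Theorems.CountingDoorF2AtThreeSchneiderOnDoorSubfamilyStubTransport

/-- **On a globally minimal model of a square-free-sieved member, `(a₁, a₃) ≠ (0, 0)`**: for `a.curve`
globally minimal and `C • a.curve` globally minimal, `Δ(C • a.curve) = u⁻¹² Δ(a) = Δ(a)` (`u = ±1`),
and `4 ∤ Δ(a)` excludes `16 ∣ Δ`, which `a₁ = a₃ = 0` would force (`Δ = 16·disc`).
[cite: SilvermanAEC2009, III.1 and VII.1.3(b)] -/
theorem a₁_ne_zero_or_a₃_ne_zero_smul_curve (a : Params) [a.curve.IsElliptic] [a.curve.IsGloballyMinimal]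
    (hΔ : ∀ ℓ : ℕ, ℓ.Prime → ¬ ((ℓ : ℤ) ^ 2 ∣ a.curveInt.Δ)) (C : VariableChange ℚ)
    [(C • a.curve).IsGloballyMinimal] : (C • a.curve).a₁ ≠ 0 ∨ (C • a.curve).a₃ ≠ 0 := by
  obtain ⟨hu, -⟩ := isGloballyMinimal_unique_holds a.curve C
  have hΔC : (C • a.curve).Δ = (a.curveInt.Δ : ℚ) := by
    rw [variableChange_Δ, Params.curve_Δ]
    rcases hu with hu | hu <;> norm_num [hu]
  refine a₁_ne_zero_or_a₃_ne_zero_of_not_sixteen_dvd hΔC fun h16 => hΔ 2 Nat.prime_two ?_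
  exact dvd_trans ⟨4, by norm_num⟩ h16

/-- **STUB 3 of line `valuation-class-at-three` (registered v3 signature, token for token) — transport.**
For a member `a` of `F₂` with square-free-sieved discriminant: if every canonical `3`-adic height datum
on `a.curve` is non-degenerate when `rank a.curve(ℚ) = 2`, then for every globally minimal model
`C • a.curve` ordinary at `3` with Mordell–Weil rank `2`, every canonical `3`-adic height datum is
non-degenerate. Unconditional: the canonical datum on `C • a.curve` itself forces the Mazur–Tate pair
(`(a₁', a₃') ≠ (0, 0)` by the sieve at `2`), and then the datum pulls back to THE canonical datum of
`a.curve` (`schneiderConjecture_transport`). [cite: MazurSteinTate2006, Thm. 1.3 and §1]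
[cite: SilvermanAEC2009, VII.1.3(b) and VIII.8.3] -/
theorem stub_transport (a : Params) (h : a.IsMember)
    (hΔ : ∀ ℓ : ℕ, ℓ.Prime → ¬ ((ℓ : ℤ) ^ 2 ∣ a.curveInt.Δ))
    (hS : ∀ Dh : PAdicHeightData a.curve 3, Dh.IsCanonical → a.curve.mordellWeilRank = 2 →
      SchneiderConjecture Dh) :
    ∀ (C : VariableChange ℚ) (hC : (C • a.curve).IsGloballyMinimal),
      @IsOrdinaryAt (C • a.curve) hC 3 _ → (C • a.curve).mordellWeilRank = 2 →
        ∀ Dh : PAdicHeightData (C • a.curve) 3, Dh.IsCanonical → SchneiderConjecture Dh := by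
  intro C hC hordC hrank Dh hDh
  haveI : a.curve.IsElliptic := Params.isElliptic_curve h
  haveI : a.curve.IsGloballyMinimal := isGloballyMinimal_curve_of_squarefree a hΔ
  -- the canonical datum on `C • a.curve` forces the Mazur–Tate pair at `3`
  have ha := a₁_ne_zero_or_a₃_ne_zero_smul_curve a hΔ C
  have hpair : ∃ σ : PowerSeries ℚ_[3], ∃ c : ℚ_[3],
      ((C • a.curve).baseChange ℚ_[3]).IsMazurTateSigmaPair σ c :=
    hDh.exists_isMazurTateSigmaPair_of_mordellWeilRank_ne_zero (by decide) (by rw [hrank]; decide) ha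
  -- transport along `pointEquiv a.curve C`
  obtain ⟨hgood, hord⟩ := good_ordinary_three_curve_of_smul a h C hordC
  have hrankW : a.curve.mordellWeilRank = 2 := by
    rw [← mordellWeilRank_variableChange_holds a.curve C]; exact hrank
  exact schneiderConjecture_transport a.curve C (by decide) hgood hord hpair
    (fun D hD => hS D hD hrankW) Dh hDh

end Summit.BirchSwinnertonDyer.BirchSwinnertonDyer.Theorems.CountingDoorF2AtThreeSchneiderOnDoorSubfamilyStubTransport

end
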